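import Summits.CriticalPhenomena.SAWScalingLimit.Theorems.SAWDefectDecoherencePolygonParitySqueezeDefs
import Summits.CriticalPhenomena.SAWScalingLimit.Theorems.SAWDefectDecoherenceBoundaryClosureRGateMassLaws
import HarnessLib

/-!
# Crux `BoundaryClosureR` (stmt-CriticalPhenomena-14004), line `polygon-parity-squeeze`:
# the collar-deleted domain `collarDomain` — elementary API for the squeeze (B)

Landing target:
`Summits/CriticalPhenomena/SAWScalingLimit/Theorems/SAWDefectDecoherenceBoundaryClosureRCollarDomain.lean`
(`--supports stmt-CriticalPhenomena-14004`; helpers of the registered stubs `stub_gateCollarAvoidance`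
(model input, audited — NOT proved here) and `stub_squeeze`).

The vocabulary file `Theorems/SAWDefectDecoherencePolygonParitySqueezeDefs.lean` defines, for a
Dobrushin datum `D`, gate radius `ρ`, root radius `r₀`, collar width `η` and mesh `δ`,
`collarDomain D ρ r₀ η δ Λ = {v ∈ Λ | η ≤ dist(δ c_v, ℂ ∖ Ω) ∨ δ c_v ∈ B(pt 0, r₀) ∨ δ c_v ∈ B(pt 1, ρ)}`
and the positive-mass input `CollarAvoidanceAt D ρ Λ a r₀` ("deleting the `η`-collar keeps `(1-ε)` of
the critical arrival mass `Z_δ(a_δ → z)` for every target `z` in the gate half-ball `B(pt 1, ρ/2)`").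
This file is the lattice bookkeeping the squeeze `collarDomain ⊆ Λ^P_δ ⊆ Λ_δ` consumes:

* membership / monotonicity (`mem_collarDomain`, `collarDomain_mono_eta`, `collarDomain_mono`,
  `collarDomain_subset_iff`, `collarDomain_eq_self`), the three ways in (`…_of_le_infDist`,
  `…_of_mem_rootBall`, `…_of_mem_gateBall`, `…_of_closedBall_subset`) and the way out
  (`ball_subset_carrier_of_mem_collarDomain`: a collar-surviving vertex outside the two pinned balls
  has its whole `η`-ball inside `Ω`);
* **the root survives**: under `PinnedFlatRoot` the root mid-edge `a δ` is eventually a BOUNDARY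
  mid-edge of the collar-deleted domain (`eventually_root_mem_boundary_collarDomain`; its inner
  endpoint has scaled centre within `δ/2` of `δ·mid(a δ) → pt 0`, hence inside `B(pt 0, r₀)`);
* **the gate targets survive**: once `δ < ρ`, every mid-edge `z` of `Λ` with `δ·mid z ∈ B(pt 1, ρ/2)`
  has all its `Λ`-endpoints inside the gate ball, so it is a mid-edge of the collar-deleted domain
  (`gateTarget_mem_hexDomainMidEdges_collarDomain`, `eventually_gateTargets_mem_midEdges_collarDomain`),
  and boundary targets stay boundary (`gateTarget_mem_hexDomainBoundary_collarDomain`);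
* **sandwiched families** `collarDomain ⊆ Λ' ⊆ Λ` (the inner polygon family of the squeeze) inherit
  the root, the normaliser, the carrier condition and both exact pinned half-lattices
  (`rootPin_of_sandwich`, `gatePin_of_sandwich`, `mem_hexDomainBoundary_of_sandwich`,
  `eventually_sandwich_frame`);
* **the sandwich** (`collarAvoidance_sandwich`): `CollarAvoidanceAt` and domain monotonicity of the
  `σ = 0` masses pinch `Z_{Λ'}` between `(1-ε) Z_Λ` and `Z_Λ` for every intermediate family
  `collarDomain ⊆ Λ' δ ⊆ Λ δ` — the form in which `stub_squeeze` uses the model input; and the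
  reduction of `CollarAvoidanceAt` to `ε < 1` (`collarAvoidanceAt_iff_lt_one`, the case `ε ≥ 1` being
  empty).

Sources: H. Duminil-Copin, S. Smirnov, Ann. of Math. 175 (2012) §2 (domains, mid-edges);
G. Lawler, O. Schramm, W. Werner (2004) §3.4 (restriction).  Deliberately NOT here: any lower bound
on collar-deleted masses (the content of `stub_gateCollarAvoidance`, conjecture-strength).
-/

noncomputable section

open scoped BigOperators Topology
open Filter Set
open Literature.Probability.LatticeModels (HexVertex hexGraph hexCenter)
open Literature.Probability.RandomPlanarGeometry
open Literature.Probability.RandomPlanarGeometry.SAW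
open Summit.CriticalPhenomena.SAWScalingLimit.Theorems.PickHalfPlane (GateMass.smul_hexCenter_mem_ball
  GateMass.norm_obs_zero_mono)

namespace Summit.CriticalPhenomena.SAWScalingLimit.Theorems.PolygonParitySqueeze

/-! ### 1. Membership and monotonicity -/

open scoped Classical in
/-- Membership in the collar-deleted domain, unfolded: `v ∈ Λ` and (`δ c_v` is `η`-deep in `Ω`, or in
the root ball, or in the gate ball). [folklore] -/
theorem mem_collarDomain : ∀ (D : DobrushinDomain) (ρ r₀ η δ : ℝ) (Λ : Finset HexVertex) (v : HexVertex), v ∈ collarDomain D ρ r₀ η δ Λ ↔ v ∈ Λ ∧ (η ≤ Metric.infDist ((δ : ℂ) * hexCenter v) D.carrierᶜ ∨ (δ : ℂ) * hexCenter v ∈ Metric.ball (D.pt 0) r₀ ∨ (δ : ℂ) * hexCenter v ∈ Metric.ball (D.pt 1) ρ) :=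
  fun _ _ _ _ _ _ _ => Finset.mem_filter

/-- A vertex of `Λ` whose scaled centre is `η`-deep in `Ω` survives the collar deletion. [folklore] -/
theorem mem_collarDomain_of_le_infDist : ∀ (D : DobrushinDomain) (ρ r₀ η δ : ℝ) (Λ : Finset HexVertex) (v : HexVertex), v ∈ Λ → η ≤ Metric.infDist ((δ : ℂ) * hexCenter v) D.carrierᶜ → v ∈ collarDomain D ρ r₀ η δ Λ :=
  fun D ρ r₀ η δ Λ v hv h => (mem_collarDomain D ρ r₀ η δ Λ v).2 ⟨hv, Or.inl h⟩

/-- A vertex of `Λ` whose scaled centre lies in the root ball `B(pt 0, r₀)` survives the collar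
deletion. [folklore] -/
theorem mem_collarDomain_of_mem_rootBall : ∀ (D : DobrushinDomain) (ρ r₀ η δ : ℝ) (Λ : Finset HexVertex) (v : HexVertex), v ∈ Λ → (δ : ℂ) * hexCenter v ∈ Metric.ball (D.pt 0) r₀ → v ∈ collarDomain D ρ r₀ η δ Λ :=
  fun D ρ r₀ η δ Λ v hv h => (mem_collarDomain D ρ r₀ η δ Λ v).2 ⟨hv, Or.inr (Or.inl h)⟩

/-- A vertex of `Λ` whose scaled centre lies in the gate ball `B(pt 1, ρ)` survives the collar
deletion. [folklore] -/
theorem mem_collarDomain_of_mem_gateBall : ∀ (D : DobrushinDomain) (ρ r₀ η δ : ℝ) (Λ : Finset HexVertex) (v : HexVertex), v ∈ Λ → (δ : ℂ) * hexCenter v ∈ Metric.ball (D.pt 1) ρ → v ∈ collarDomain D ρ r₀ η δ Λ :=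
  fun D ρ r₀ η δ Λ v hv h => (mem_collarDomain D ρ r₀ η δ Λ v).2 ⟨hv, Or.inr (Or.inr h)⟩

/-- **Inside the root ball nothing is deleted**: for `δ c_v ∈ B(pt 0, r₀)`, `v ∈ collarDomain ↔ v ∈ Λ`
(so the exact root half-lattice of `Λ` is that of the collar-deleted domain). [folklore] -/
theorem mem_collarDomain_iff_of_mem_rootBall : ∀ (D : DobrushinDomain) (ρ r₀ η δ : ℝ) (Λ : Finset HexVertex) (v : HexVertex), (δ : ℂ) * hexCenter v ∈ Metric.ball (D.pt 0) r₀ → (v ∈ collarDomain D ρ r₀ η δ Λ ↔ v ∈ Λ) :=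
  fun D ρ r₀ η δ Λ v h =>
    ⟨fun hv => collarDomain_subset D ρ r₀ η δ Λ hv, fun hv => mem_collarDomain_of_mem_rootBall D ρ r₀ η δ Λ v hv h⟩

/-- **Inside the gate ball nothing is deleted**: for `δ c_v ∈ B(pt 1, ρ)`, `v ∈ collarDomain ↔ v ∈ Λ`
(so the exact gate half-lattice of `Λ` is that of the collar-deleted domain). [folklore] -/
theorem mem_collarDomain_iff_of_mem_gateBall : ∀ (D : DobrushinDomain) (ρ r₀ η δ : ℝ) (Λ : Finset HexVertex) (v : HexVertex), (δ : ℂ) * hexCenter v ∈ Metric.ball (D.pt 1) ρ → (v ∈ collarDomain D ρ r₀ η δ Λ ↔ v ∈ Λ) :=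
  fun D ρ r₀ η δ Λ v h =>
    ⟨fun hv => collarDomain_subset D ρ r₀ η δ Λ hv, fun hv => mem_collarDomain_of_mem_gateBall D ρ r₀ η δ Λ v hv h⟩

/-- **Deep vertices survive** (the form the inner-polygon construction uses): if the CLOSED `η`-ball
about the scaled centre of `v ∈ Λ` lies in `Ω`, then `v` survives the collar deletion (`ℂ ∖ Ω` is
nonempty, `Ω` being bounded, and each of its points is at distance `≥ η`). [folklore] -/
theorem mem_collarDomain_of_closedBall_subset : ∀ (D : DobrushinDomain) (ρ r₀ η δ : ℝ) (Λ : Finset HexVertex) (v : HexVertex), v ∈ Λ → Metric.closedBall ((δ : ℂ) * hexCenter v) η ⊆ D.carrier → v ∈ collarDomain D ρ r₀ η δ Λ := by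
  intro D ρ r₀ η δ Λ v hv hball
  refine mem_collarDomain_of_le_infDist D ρ r₀ η δ Λ v hv ?_
  have hne : D.carrierᶜ.Nonempty := Set.nonempty_compl.2 D.carrier_ne_univ
  rw [Metric.le_infDist hne]
  intro y hy
  by_contra h
  exact hy (hball (Metric.mem_closedBall'.2 (not_le.1 h).le))

/-- **The way out**: a collar-surviving vertex is `η`-deep (its open `η`-ball lies in `Ω`), or its
scaled centre lies in one of the two pinned balls. [folklore] -/
theorem ball_subset_carrier_of_mem_collarDomain : ∀ (D : DobrushinDomain) (ρ r₀ η δ : ℝ) (Λ : Finset HexVertex) (v : HexVertex), v ∈ collarDomain D ρ r₀ η δ Λ → Metric.ball ((δ : ℂ) * hexCenter v) η ⊆ D.carrier ∨ (δ : ℂ) * hexCenter v ∈ Metric.ball (D.pt 0) r₀ ∨ (δ : ℂ) * hexCenter v ∈ Metric.ball (D.pt 1) ρ := by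
  intro D ρ r₀ η δ Λ v hv
  rcases ((mem_collarDomain D ρ r₀ η δ Λ v).1 hv).2 with h | h | h
  · exact Or.inl ((Metric.ball_subset_ball h).trans Metric.ball_infDist_compl_subset)
  · exact Or.inr (Or.inl h)
  · exact Or.inr (Or.inr h)

/-- **Monotonicity in the collar width**: a thinner collar deletes less,
`η ≤ η' ⟹ collarDomain η' ⊆ collarDomain η`. [folklore] -/
theorem collarDomain_mono_eta : ∀ (D : DobrushinDomain) (ρ r₀ η η' δ : ℝ) (Λ : Finset HexVertex), η ≤ η' → collarDomain D ρ r₀ η' δ Λ ⊆ collarDomain D ρ r₀ η δ Λ := by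
  intro D ρ r₀ η η' δ Λ hη v hv
  obtain ⟨hvΛ, h⟩ := (mem_collarDomain D ρ r₀ η' δ Λ v).1 hv
  exact (mem_collarDomain D ρ r₀ η δ Λ v).2 ⟨hvΛ, h.imp (fun h' => hη.trans h') id⟩

open scoped Classical in
/-- **Monotonicity in the domain**: `Λ ⊆ Λ' ⟹ collarDomain Λ ⊆ collarDomain Λ'` (same datum, radii,
width and mesh). [folklore] -/
theorem collarDomain_mono : ∀ (D : DobrushinDomain) (ρ r₀ η δ : ℝ) (Λ Λ' : Finset HexVertex), Λ ⊆ Λ' → collarDomain D ρ r₀ η δ Λ ⊆ collarDomain D ρ r₀ η δ Λ' :=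
  fun _ _ _ _ _ _ _ h => Finset.filter_subset_filter _ h

/-- For `Λ ⊆ Λ'` the collar-deleted domain of `Λ` is the trace on `Λ` of that of `Λ'` (the survival
condition only depends on the vertex). [folklore] -/
theorem mem_collarDomain_iff_of_subset : ∀ (D : DobrushinDomain) (ρ r₀ η δ : ℝ) (Λ Λ' : Finset HexVertex) (v : HexVertex), Λ ⊆ Λ' → (v ∈ collarDomain D ρ r₀ η δ Λ ↔ v ∈ Λ ∧ v ∈ collarDomain D ρ r₀ η δ Λ') := by
  intro D ρ r₀ η δ Λ Λ' v h
  rw [mem_collarDomain, mem_collarDomain]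
  exact ⟨fun hv => ⟨hv.1, h hv.1, hv.2⟩, fun hv => ⟨hv.1, hv.2.2⟩⟩

/-- **Containment test** for the squeeze (`collarDomain ⊆ Λ^P_δ`): the collar-deleted domain lies in
`Λ'` iff every vertex of `Λ` satisfying the survival condition lies in `Λ'`. [folklore] -/
theorem collarDomain_subset_iff : ∀ (D : DobrushinDomain) (ρ r₀ η δ : ℝ) (Λ Λ' : Finset HexVertex), collarDomain D ρ r₀ η δ Λ ⊆ Λ' ↔ ∀ v ∈ Λ, (η ≤ Metric.infDist ((δ : ℂ) * hexCenter v) D.carrierᶜ ∨ (δ : ℂ) * hexCenter v ∈ Metric.ball (D.pt 0) r₀ ∨ (δ : ℂ) * hexCenter v ∈ Metric.ball (D.pt 1) ρ) → v ∈ Λ' := by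
  intro D ρ r₀ η δ Λ Λ'
  constructor
  · intro h v hv hcond
    exact h ((mem_collarDomain D ρ r₀ η δ Λ v).2 ⟨hv, hcond⟩)
  · intro h v hv
    obtain ⟨hvΛ, hcond⟩ := (mem_collarDomain D ρ r₀ η δ Λ v).1 hv
    exact h v hvΛ hcond

open scoped Classical in
/-- If every vertex of `Λ` satisfies the survival condition (e.g. the whole carrier sits inside the
root ball — overlapping pins), nothing is deleted: `collarDomain Λ = Λ`. [folklore] -/
theorem collarDomain_eq_self : ∀ (D : DobrushinDomain) (ρ r₀ η δ : ℝ) (Λ : Finset HexVertex), (∀ v ∈ Λ, η ≤ Metric.infDist ((δ : ℂ) * hexCenter v) D.carrierᶜ ∨ (δ : ℂ) * hexCenter v ∈ Metric.ball (D.pt 0) r₀ ∨ (δ : ℂ) * hexCenter v ∈ Metric.ball (D.pt 1) ρ) → collarDomain D ρ r₀ η δ Λ = Λ :=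
  fun _ _ _ _ _ _ h => Finset.filter_true_of_mem h

/-! ### 2. The root survives the collar deletion -/

/-- **The root stays a boundary mid-edge** (one mesh): if `0 ≤ δ < r₀`, `a ∈ ∂Ω(Λ)` and
`δ·mid a ∈ B(pt 0, r₀/2)`, then `a ∈ ∂Ω(collarDomain)`: the inner endpoint of `a` has scaled centre
within `δ/2` of `δ·mid a` (edge length `1/√3 ≤ 1`), hence in the root ball, so it survives, while
the outer endpoint stays outside. [cite: DuminilCopinSmirnov2012, §2 (domains, boundary mid-edges)] -/
theorem root_mem_hexDomainBoundary_collarDomain : ∀ (D : DobrushinDomain) (ρ r₀ η δ : ℝ) (Λ : Finset HexVertex) (a : Sym2 HexVertex), 0 ≤ δ → δ < r₀ → a ∈ hexDomainBoundary Λ → (δ : ℂ) * hexMidpoint a ∈ Metric.ball (D.pt 0) (r₀ / 2) → a ∈ hexDomainBoundary (collarDomain D ρ r₀ η δ Λ) := by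
  intro D ρ r₀ η δ Λ a hδ hδr ha hmid
  obtain ⟨hedge, u, v, rfl, hv, hu⟩ := ha
  have hball : (δ : ℂ) * hexCenter v ∈ Metric.ball (D.pt 0) r₀ := by
    refine GateMass.smul_hexCenter_mem_ball hδ hedge (Sym2.mem_mk_right u v) ?_
    have : dist ((δ : ℂ) * hexMidpoint s(u, v)) (D.pt 0) < r₀ / 2 := hmid
    linarith
  exact ⟨hedge, u, v, rfl, mem_collarDomain_of_mem_rootBall D ρ r₀ η δ Λ v hv hball,
    fun hu' => hu (collarDomain_subset D ρ r₀ η δ Λ hu')⟩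

/-- **The root survives, eventually** (sub-goal of `stub_squeeze`, audit item of
`stub_gateCollarAvoidance`): under `PinnedFlatRoot D Λ b (pt 0) a r₀ m₀`, for EVERY collar width `η`,
eventually in `δ → 0⁺` the root `a δ` is a boundary mid-edge of the collar-deleted domain
`collarDomain D ρ r₀ η δ (Λ δ)` (so the collar-deleted arrival masses `Z(a δ → ·)` are rooted on the
boundary and `Z(a δ → a δ) = 1`): `a δ ∈ ∂Ω(Λ δ)` eventually, `δ·mid(a δ) → pt 0` and `r₀ > 0`.
[cite: DuminilCopinSmirnov2012, §2 (domains, boundary mid-edges)] -/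
theorem eventually_root_mem_boundary_collarDomain : ∀ (D : DobrushinDomain) (ρ : ℝ) (Λ : ℝ → Finset HexVertex) (b : ℝ → Sym2 HexVertex) (a : ℝ → Sym2 HexVertex) (r₀ : ℝ) (m₀ : ℝ → ℤ), PinnedFlatRoot D Λ b (D.pt 0) a r₀ m₀ → ∀ η : ℝ, ∀ᶠ δ : ℝ in 𝓝[>] 0, a δ ∈ hexDomainBoundary (collarDomain D ρ r₀ η δ (Λ δ)) := by
  intro D ρ Λ b a r₀ m₀ hPR η
  have hr : 0 < r₀ := hPR.1
  have hnear : ∀ᶠ δ : ℝ in 𝓝[>] 0, (δ : ℂ) * hexMidpoint (a δ) ∈ Metric.ball (D.pt 0) (r₀ / 2) :=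
    hPR.2.2.2 (Metric.ball_mem_nhds _ (half_pos hr))
  have hδ : ∀ᶠ δ : ℝ in 𝓝[>] 0, δ ∈ Set.Ioo 0 r₀ := Ioo_mem_nhdsGT hr
  filter_upwards [hPR.2.2.1, hnear, hδ] with δ hbd hmid hδ
  exact root_mem_hexDomainBoundary_collarDomain D ρ r₀ η δ (Λ δ) (a δ) hδ.1.le hδ.2 hbd.1 hmid

/-! ### 3. The gate targets survive the collar deletion -/

/-- **Endpoints of gate targets survive** (one mesh): if `0 ≤ δ < ρ` and `z` is an edge of `ℍ` with
`δ·mid z ∈ B(pt 1, ρ/2)`, then every endpoint of `z` lying in `Λ` survives the collar deletion (its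
scaled centre is within `δ/2 < ρ/2` of `δ·mid z`, hence in the gate ball). [cite: DuminilCopinSmirnov2012, §2 (domains)] -/
theorem endpoint_mem_collarDomain_of_gateTarget : ∀ (D : DobrushinDomain) (ρ r₀ η δ : ℝ) (Λ : Finset HexVertex) (z : Sym2 HexVertex), 0 ≤ δ → δ < ρ → z ∈ hexGraph.edgeSet → (δ : ℂ) * hexMidpoint z ∈ Metric.ball (D.pt 1) (ρ / 2) → ∀ v ∈ z, v ∈ Λ → v ∈ collarDomain D ρ r₀ η δ Λ := by
  intro D ρ r₀ η δ Λ z hδ hδρ hz hmid v hv hvΛ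
  refine mem_collarDomain_of_mem_gateBall D ρ r₀ η δ Λ v hvΛ
    (GateMass.smul_hexCenter_mem_ball hδ hz hv ?_)
  have : dist ((δ : ℂ) * hexMidpoint z) (D.pt 1) < ρ / 2 := hmid
  linarith

/-- **Gate targets stay mid-edges** (one mesh): if `0 ≤ δ < ρ`, every mid-edge `z ∈ Ω(Λ)` with
`δ·mid z ∈ B(pt 1, ρ/2)` is a mid-edge of the collar-deleted domain. [cite: DuminilCopinSmirnov2012, §2 (domains)] -/
theorem gateTarget_mem_hexDomainMidEdges_collarDomain : ∀ (D : DobrushinDomain) (ρ r₀ η δ : ℝ) (Λ : Finset HexVertex) (z : Sym2 HexVertex), 0 ≤ δ → δ < ρ → z ∈ hexDomainMidEdges Λ → (δ : ℂ) * hexMidpoint z ∈ Metric.ball (D.pt 1) (ρ / 2) → z ∈ hexDomainMidEdges (collarDomain D ρ r₀ η δ Λ) := by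
  intro D ρ r₀ η δ Λ z hδ hδρ hz hmid
  obtain ⟨hedge, v, hv, hvΛ⟩ := hz
  exact ⟨hedge, v, hv,
    endpoint_mem_collarDomain_of_gateTarget D ρ r₀ η δ Λ z hδ hδρ hedge hmid v hv hvΛ⟩

/-- **Boundary gate targets stay boundary** (one mesh): if `0 ≤ δ < ρ`, every boundary mid-edge
`z ∈ ∂Ω(Λ)` with `δ·mid z ∈ B(pt 1, ρ/2)` (e.g. the normaliser `b δ`, the gate floor edges) is a
boundary mid-edge of the collar-deleted domain. [cite: DuminilCopinSmirnov2012, §2 (domains)] -/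
theorem gateTarget_mem_hexDomainBoundary_collarDomain : ∀ (D : DobrushinDomain) (ρ r₀ η δ : ℝ) (Λ : Finset HexVertex) (z : Sym2 HexVertex), 0 ≤ δ → δ < ρ → z ∈ hexDomainBoundary Λ → (δ : ℂ) * hexMidpoint z ∈ Metric.ball (D.pt 1) (ρ / 2) → z ∈ hexDomainBoundary (collarDomain D ρ r₀ η δ Λ) := by
  intro D ρ r₀ η δ Λ z hδ hδρ hz hmid
  obtain ⟨hedge, u, v, rfl, hv, hu⟩ := hz
  exact ⟨hedge, u, v, rfl, endpoint_mem_collarDomain_of_gateTarget D ρ r₀ η δ Λ _ hδ hδρ hedge hmid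
    v (Sym2.mem_mk_right u v) hv, fun hu' => hu (collarDomain_subset D ρ r₀ η δ Λ hu')⟩

/-- **Gate targets survive, eventually** (sub-goal of `stub_squeeze`): for `ρ > 0` and every family
`Λ`, root radius and collar width, eventually in `δ → 0⁺` every mid-edge `z ∈ Ω(Λ δ)` with
`δ·mid z ∈ B(pt 1, ρ/2)` is a mid-edge of `collarDomain D ρ r₀ η δ (Λ δ)` (only `δ < ρ` is used).
[cite: DuminilCopinSmirnov2012, §2 (domains)] -/
theorem eventually_gateTargets_mem_midEdges_collarDomain : ∀ (D : DobrushinDomain) (ρ r₀ η : ℝ) (Λ : ℝ → Finset HexVertex), 0 < ρ → ∀ᶠ δ : ℝ in 𝓝[>] 0, ∀ z ∈ hexDomainMidEdges (Λ δ), (δ : ℂ) * hexMidpoint z ∈ Metric.ball (D.pt 1) (ρ / 2) → z ∈ hexDomainMidEdges (collarDomain D ρ r₀ η δ (Λ δ)) := by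
  intro D ρ r₀ η Λ hρ
  have hδ : ∀ᶠ δ : ℝ in 𝓝[>] 0, δ ∈ Set.Ioo 0 ρ := Ioo_mem_nhdsGT hρ
  filter_upwards [hδ] with δ hδ z hz hmid
  exact gateTarget_mem_hexDomainMidEdges_collarDomain D ρ r₀ η δ (Λ δ) z hδ.1.le hδ.2 hz hmid

/-- **Boundary gate targets survive, eventually**: same for boundary mid-edges.
[cite: DuminilCopinSmirnov2012, §2 (domains)] -/
theorem eventually_gateTargets_mem_boundary_collarDomain : ∀ (D : DobrushinDomain) (ρ r₀ η : ℝ) (Λ : ℝ → Finset HexVertex), 0 < ρ → ∀ᶠ δ : ℝ in 𝓝[>] 0, ∀ z ∈ hexDomainBoundary (Λ δ), (δ : ℂ) * hexMidpoint z ∈ Metric.ball (D.pt 1) (ρ / 2) → z ∈ hexDomainBoundary (collarDomain D ρ r₀ η δ (Λ δ)) := by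
  intro D ρ r₀ η Λ hρ
  have hδ : ∀ᶠ δ : ℝ in 𝓝[>] 0, δ ∈ Set.Ioo 0 ρ := Ioo_mem_nhdsGT hρ
  filter_upwards [hδ] with δ hδ z hz hmid
  exact gateTarget_mem_hexDomainBoundary_collarDomain D ρ r₀ η δ (Λ δ) z hδ.1.le hδ.2 hz hmid

/-! ### 4. The sandwich and the trivial range of `ε` -/

/-- **Upper half of the sandwich**: the collar-deleted arrival masses never exceed the original ones,
`Z_{collarDomain}(a → z) ≤ Z_Λ(a → z)` (domain monotonicity of the `σ = 0` masses, `collarDomain ⊆ Λ`).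
[cite: LawlerSchrammWerner2004SAW, §3.4 ("SAW satisfies restriction")] -/
theorem norm_obs_zero_collarDomain_le : ∀ (D : DobrushinDomain) (ρ r₀ η δ : ℝ) (Λ : Finset HexVertex) (a z : Sym2 HexVertex), ‖hexParafermionicObservable (collarDomain D ρ r₀ η δ Λ) a hexCriticalFugacity 0 z‖ ≤ ‖hexParafermionicObservable Λ a hexCriticalFugacity 0 z‖ :=
  fun D ρ r₀ η δ Λ a z => GateMass.norm_obs_zero_mono (collarDomain_subset D ρ r₀ η δ Λ) a z

/-- **The squeeze sandwich** (how `stub_squeeze` consumes `stub_gateCollarAvoidance`): if collar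
avoidance holds for the family `(D, ρ, Λ, a, r₀)`, then for every `ε > 0` there is a collar width
`η > 0` such that for EVERY intermediate family `Λ'` with `collarDomain D ρ r₀ η δ (Λ δ) ⊆ Λ' δ ⊆ Λ δ`
eventually (e.g. the exact inner polygon family `Λ^P`), eventually every gate target `z` satisfies
`(1 - ε) Z_Λ(a δ → z) ≤ Z_{Λ'}(a δ → z) ≤ Z_Λ(a δ → z)` (lower: collar avoidance then monotonicity
`collarDomain ⊆ Λ'`; upper: monotonicity `Λ' ⊆ Λ`).
[cite: LawlerSchrammWerner2004SAW, §3.4 (restriction / boundary scaling heuristics)] -/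
theorem collarAvoidance_sandwich : ∀ (D : DobrushinDomain) (ρ : ℝ) (Λ : ℝ → Finset HexVertex) (a : ℝ → Sym2 HexVertex) (r₀ : ℝ), CollarAvoidanceAt D ρ Λ a r₀ → ∀ ε : ℝ, 0 < ε → ∃ η : ℝ, 0 < η ∧ ∀ Λ' : ℝ → Finset HexVertex, (∀ᶠ δ : ℝ in 𝓝[>] 0, collarDomain D ρ r₀ η δ (Λ δ) ⊆ Λ' δ ∧ Λ' δ ⊆ Λ δ) → ∀ᶠ δ : ℝ in 𝓝[>] 0, ∀ z ∈ hexDomainMidEdges (Λ δ), (δ : ℂ) * hexMidpoint z ∈ Metric.ball (D.pt 1) (ρ / 2) → (1 - ε) * ‖hexParafermionicObservable (Λ δ) (a δ) hexCriticalFugacity 0 z‖ ≤ ‖hexParafermionicObservable (Λ' δ) (a δ) hexCriticalFugacity 0 z‖ ∧ ‖hexParafermionicObservable (Λ' δ) (a δ) hexCriticalFugacity 0 z‖ ≤ ‖hexParafermionicObservable (Λ δ) (a δ) hexCriticalFugacity 0 z‖ := by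
  intro D ρ Λ a r₀ hCA ε hε
  obtain ⟨η, hη, hev⟩ := hCA ε hε
  refine ⟨η, hη, fun Λ' hΛ' => ?_⟩
  filter_upwards [hev, hΛ'] with δ h1 h2 z hz hmid
  exact ⟨(h1 z hz hmid).trans (GateMass.norm_obs_zero_mono h2.1 _ _),
    GateMass.norm_obs_zero_mono h2.2 _ _⟩

/-- **Only `ε < 1` matters**: for `ε ≥ 1` the collar-avoidance inequality
`(1 - ε) Z_Λ ≤ Z_{collarDomain}` is empty (left side `≤ 0 ≤` right side), so `CollarAvoidanceAt` is
equivalent to its restriction to `0 < ε < 1`. [folklore] -/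
theorem collarAvoidanceAt_iff_lt_one : ∀ (D : DobrushinDomain) (ρ : ℝ) (Λ : ℝ → Finset HexVertex) (a : ℝ → Sym2 HexVertex) (r₀ : ℝ), CollarAvoidanceAt D ρ Λ a r₀ ↔ ∀ ε : ℝ, 0 < ε → ε < 1 → ∃ η : ℝ, 0 < η ∧ ∀ᶠ δ : ℝ in 𝓝[>] 0, ∀ z ∈ hexDomainMidEdges (Λ δ), (δ : ℂ) * hexMidpoint z ∈ Metric.ball (D.pt 1) (ρ / 2) → (1 - ε) * ‖hexParafermionicObservable (Λ δ) (a δ) hexCriticalFugacity 0 z‖ ≤ ‖hexParafermionicObservable (collarDomain D ρ r₀ η δ (Λ δ)) (a δ) hexCriticalFugacity 0 z‖ := by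
  intro D ρ Λ a r₀
  refine ⟨fun h ε hε _ => h ε hε, fun h ε hε => ?_⟩
  by_cases hε1 : ε < 1
  · exact h ε hε hε1
  · refine ⟨1, one_pos, Filter.Eventually.of_forall fun δ z _ _ => ?_⟩
    have h0 : (1 - ε) * ‖hexParafermionicObservable (Λ δ) (a δ) hexCriticalFugacity 0 z‖ ≤ 0 :=
      mul_nonpos_of_nonpos_of_nonneg (by linarith [not_lt.1 hε1]) (norm_nonneg _)
    exact h0.trans (norm_nonneg _)

/-! ### 5. Frames of a sandwiched family `collarDomain ⊆ Λ' ⊆ Λ` -/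

/-- **Pins pass to sandwiched domains (root ball)**: if `collarDomain D ρ r₀ η δ Λ ⊆ Λ' ⊆ Λ` and
membership in `Λ` is decided by the row threshold `m₀` on the root ball `B(pt 0, r₀)`, then so is
membership in `Λ'` (the root ball is untouched by the collar deletion). [folklore] -/
theorem rootPin_of_sandwich : ∀ (D : DobrushinDomain) (ρ r₀ η δ : ℝ) (Λ Λ' : Finset HexVertex) (m₀ : ℤ), collarDomain D ρ r₀ η δ Λ ⊆ Λ' → Λ' ⊆ Λ → (∀ v : HexVertex, (δ : ℂ) * hexCenter v ∈ Metric.ball (D.pt 0) r₀ → (v ∈ Λ ↔ m₀ ≤ v.1 1)) → ∀ v : HexVertex, (δ : ℂ) * hexCenter v ∈ Metric.ball (D.pt 0) r₀ → (v ∈ Λ' ↔ m₀ ≤ v.1 1) := by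
  intro D ρ r₀ η δ Λ Λ' m₀ h1 h2 hpin v hv
  rw [← hpin v hv]
  exact ⟨fun h => h2 h, fun h => h1 (mem_collarDomain_of_mem_rootBall D ρ r₀ η δ Λ v h hv)⟩

/-- **Pins pass to sandwiched domains (gate ball)**: if `collarDomain D ρ r₀ η δ Λ ⊆ Λ' ⊆ Λ` and
membership in `Λ` is decided by the row threshold `m` on the gate ball `B(pt 1, ρ)`, then so is
membership in `Λ'`. [folklore] -/
theorem gatePin_of_sandwich : ∀ (D : DobrushinDomain) (ρ r₀ η δ : ℝ) (Λ Λ' : Finset HexVertex) (m : ℤ), collarDomain D ρ r₀ η δ Λ ⊆ Λ' → Λ' ⊆ Λ → (∀ v : HexVertex, (δ : ℂ) * hexCenter v ∈ Metric.ball (D.pt 1) ρ → (v ∈ Λ ↔ m ≤ v.1 1)) → ∀ v : HexVertex, (δ : ℂ) * hexCenter v ∈ Metric.ball (D.pt 1) ρ → (v ∈ Λ' ↔ m ≤ v.1 1) := by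
  intro D ρ r₀ η δ Λ Λ' m h1 h2 hpin v hv
  rw [← hpin v hv]
  exact ⟨fun h => h2 h, fun h => h1 (mem_collarDomain_of_mem_gateBall D ρ r₀ η δ Λ v h hv)⟩

/-- **Boundary mid-edges pass to sandwiched domains**: for `Λ₁ ⊆ Λ' ⊆ Λ`, a mid-edge that is a
boundary mid-edge of both `Λ₁` and `Λ` is a boundary mid-edge of `Λ'` (its inner endpoint for `Λ₁`
lies in `Λ'`; the other endpoint is then the outer endpoint for `Λ`, hence outside `Λ'`).
[cite: DuminilCopinSmirnov2012, §2 (domains, boundary mid-edges)] -/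
theorem mem_hexDomainBoundary_of_sandwich : ∀ (Λ₁ Λ' Λ : Finset HexVertex) (e : Sym2 HexVertex), Λ₁ ⊆ Λ' → Λ' ⊆ Λ → e ∈ hexDomainBoundary Λ → e ∈ hexDomainBoundary Λ₁ → e ∈ hexDomainBoundary Λ' := by
  intro Λ₁ Λ' Λ e h1 h2 hΛ hΛ₁
  obtain ⟨hedge, u, v, rfl, hv, hu⟩ := hΛ₁
  obtain ⟨-, u₂, v₂, he, hv₂, hu₂⟩ := hΛ
  refine ⟨hedge, u, v, rfl, h1 hv, fun hu' => ?_⟩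
  rcases Sym2.eq_iff.1 he with ⟨rfl, rfl⟩ | ⟨rfl, rfl⟩
  · exact hu₂ (h2 hu')
  · exact hu₂ (h2 (h1 hv))

/-- **Frame of a sandwiched family, eventually** (the bookkeeping `stub_squeeze` needs for the inner
polygon family `Λ^P` with `collarDomain ⊆ Λ^P_δ ⊆ Λ_δ`): under `AdmissibleFamily D ρ Λ m b` and
`PinnedFlatRoot D Λ b (pt 0) a r₀ m₀`, every family `Λ'` sandwiched eventually between the
collar-deleted domain (any width `η`) and `Λ δ` eventually has the SAME root `a δ ∈ ∂Ω(Λ' δ)`, the same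
normaliser `b δ ∈ ∂Ω(Λ' δ)`, scaled centres in the carrier, and the same exact half-lattices on the
two pinned balls (thresholds `m δ`, `m₀ δ`).
[cite: DuminilCopinSmirnov2012, §2 (domains, boundary mid-edges)] -/
theorem eventually_sandwich_frame : ∀ (D : DobrushinDomain) (ρ : ℝ) (Λ : ℝ → Finset HexVertex) (m : ℝ → ℤ) (b : ℝ → Sym2 HexVertex), AdmissibleFamily D ρ Λ m b → ∀ (a : ℝ → Sym2 HexVertex) (r₀ : ℝ) (m₀ : ℝ → ℤ), PinnedFlatRoot D Λ b (D.pt 0) a r₀ m₀ → ∀ (η : ℝ) (Λ' : ℝ → Finset HexVertex), (∀ᶠ δ : ℝ in 𝓝[>] 0, collarDomain D ρ r₀ η δ (Λ δ) ⊆ Λ' δ ∧ Λ' δ ⊆ Λ δ) → ∀ᶠ δ : ℝ in 𝓝[>] 0, a δ ∈ hexDomainBoundary (Λ' δ) ∧ b δ ∈ hexDomainBoundary (Λ' δ) ∧ (∀ v ∈ Λ' δ, (δ : ℂ) * hexCenter v ∈ D.carrier) ∧ (∀ v : HexVertex, (δ : ℂ) * hexCenter v ∈ Metric.ball (D.pt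 1) ρ → (v ∈ Λ' δ ↔ m δ ≤ v.1 1)) ∧ (∀ v : HexVertex, (δ : ℂ) * hexCenter v ∈ Metric.ball (D.pt 0) r₀ → (v ∈ Λ' δ ↔ m₀ δ ≤ v.1 1)) := by
  intro D ρ Λ m b hAF a r₀ m₀ hPR η Λ' hΛ'
  have hρ : 0 < ρ := hAF.1
  have hbnear : ∀ᶠ δ : ℝ in 𝓝[>] 0, (δ : ℂ) * hexMidpoint (b δ) ∈ Metric.ball (D.pt 1) (ρ / 2) :=
    hAF.2.2.2.2 (Metric.ball_mem_nhds _ (half_pos hρ))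
  filter_upwards [hAF.2.2.1, hPR.2.2.1, hΛ', eventually_root_mem_boundary_collarDomain D ρ Λ b a r₀ m₀ hPR η,
    eventually_gateTargets_mem_boundary_collarDomain D ρ r₀ η Λ hρ, hbnear]
    with δ hAFδ hPRδ hsand hroot hgate hbδ
  refine ⟨mem_hexDomainBoundary_of_sandwich _ _ _ _ hsand.1 hsand.2 hPRδ.1 hroot,
    mem_hexDomainBoundary_of_sandwich _ _ _ _ hsand.1 hsand.2 hAFδ.2.1 (hgate _ hAFδ.2.1 hbδ),
    fun v hv => hAFδ.2.2.2.1 v (hsand.2 hv),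
    gatePin_of_sandwich D ρ r₀ η δ (Λ δ) (Λ' δ) (m δ) hsand.1 hsand.2 hAFδ.2.2.2.2,
    rootPin_of_sandwich D ρ r₀ η δ (Λ δ) (Λ' δ) (m₀ δ) hsand.1 hsand.2 hPRδ.2.2⟩

end Summit.CriticalPhenomena.SAWScalingLimit.Theorems.PolygonParitySqueeze

end
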